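import Literature.Probability.LatticeModels.ProdBernoulliAtomExpansion
import Summits.CriticalPhenomena.PercolationContinuityZ3.Theorems.PercNearOneGluingNoHeavyLowerTailCoreExchangeSteinerFree
import Summits.CriticalPhenomena.PercolationContinuityZ3.Theorems.PercNearOneGluingNoHeavyLowerTailCoreExchange
import HarnessLib

/-!
# `NoHeavyLowerTail` (stmt-CriticalPhenomena-4575) — RC1 when the observer's neighbours are terminals, and the
# floating-sink REG₂ / RWF₂ corollaries

Support file (prover `prim-lf-1`; `--supports stmt-CriticalPhenomena-4575`).  No definitions, no named facts, no sorries.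
Continues `…CoreExchangeSteinerFree.lean` (the two-copy swap): the pointwise lemma `hybrid_mem_T_of_terminalNbrs`
needs only that the first copy's open edges at `o` end at `a`, `b` or a core vertex, so
(1) `corePairExchange_inter_terminalNbrs`: RC1 restricted to the event `N` = "every open edge at `o` ends at a
terminal", on ANY vertex set, every weight (sure statement);
(2) `corePairExchange_of_terminalNbrs`: the full RC1 `S_a S_b ≤ T_a T_b` whenever the edges from `o` to non-terminal
vertices carry weight `0` (weight-zero edges are a.s. closed, `prodBernoulli_setOf_exists_mem_eq_zero`), i.e. on every
support whose neighbours of `o` are terminals — Steiner vertices elsewhere allowed (generalises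
`steinerFree_corePairExchange`);
(3) the floating-sink event gluing REG₂ and worst-first packing RWF₂ in both situations, by
`CoreExchange.eventGluing_pair_within` / `CoreExchange.worstFirst_two_mul_within` with `Γ = ⋂_{r ∈ R} {c ↔ r}`.
STATUS (seat note): written 2026-08-19 while the farm had no oleans for the two Summits imports; the two measure-level
proofs elaborated inside the SteinerFree draft (rc 0); the corollaries are direct applications.  CHECK before proposing.
-/

noncomputable section

namespace Summit.CriticalPhenomena.PercolationContinuityZ3.Theorems

open MeasureTheory Set Literature.Probability.LatticeModels Literature.Probability.Percolation
open scoped Classical BigOperators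

namespace CoreExchange

variable {n : ℕ}

/-- **RC1 on the event "the open edges at `o` end at terminals" (sure statement, any vertex set).**  With
`N = {ω | every open edge s(o,z), z ≠ o, has z = a, z = b or z ∈ R}`:
`μ(S_a ∩ N) · μ(S_b ∩ N) ≤ μ(T_a) · μ(T_b)` for every weight vector (events as in
`steinerFree_corePairExchange`; `a, b ≠ o`, `c ∈ R`). [this file] -/
theorem corePairExchange_inter_terminalNbrs (w : Sym2 (Fin n) → unitInterval) (o a b c : Fin n)
    (R : Finset (Fin n)) (hao : a ≠ o) (hbo : b ≠ o) :
    (prodBernoulli w).real ((⋂ r ∈ R, (openConn c r : Set (BondConfig (Fin n)))) ∩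
          (openConn o a : Set (BondConfig (Fin n)))ᶜ ∩ (openConn o c)ᶜ ∩ openConn o b ∩
          {ω : BondConfig (Fin n) | ∀ z, z ≠ o → s(o, z) ∈ ω → (z = a ∨ z = b ∨ z ∈ R)}) *
        (prodBernoulli w).real ((⋂ r ∈ R, (openConn c r : Set (BondConfig (Fin n)))) ∩
          (openConn o b : Set (BondConfig (Fin n)))ᶜ ∩ (openConn o c)ᶜ ∩ openConn o a ∩
          {ω : BondConfig (Fin n) | ∀ z, z ≠ o → s(o, z) ∈ ω → (z = a ∨ z = b ∨ z ∈ R)}) ≤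
      (prodBernoulli w).real ((⋂ r ∈ R, (openConn c r : Set (BondConfig (Fin n)))) ∩
          (openConn o a : Set (BondConfig (Fin n)))ᶜ ∩ (openConn a c)ᶜ) *
        (prodBernoulli w).real ((⋂ r ∈ R, (openConn c r : Set (BondConfig (Fin n)))) ∩
          (openConn o b : Set (BondConfig (Fin n)))ᶜ ∩ (openConn b c)ᶜ) := by
  classical
  have memΓ : ∀ ω : BondConfig (Fin n), ω ∈ (⋂ r ∈ R, (openConn c r : Set (BondConfig (Fin n)))) ↔
      ∀ r ∈ R, (openGraph ω).Reachable c r := fun ω => by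
    simp only [Set.mem_iInter]; rfl
  refine prodBernoulli_pair_le_of_swap w Finset.univ (fun j => o ∉ (j : Sym2 (Fin n)))
    (determinedBy_coe_univ _) (determinedBy_coe_univ _) (determinedBy_coe_univ _) (determinedBy_coe_univ _) ?_
  intro y x hy hx
  obtain ⟨⟨⟨⟨hΓ1, h1oa⟩, h1oc⟩, h1ob⟩, hN1⟩ := hy
  obtain ⟨⟨⟨⟨hΓ2, h2ob⟩, h2oc⟩, h2oa⟩, hN2⟩ := hx
  rw [memΓ] at hΓ1 hΓ2
  change ¬ (openGraph _).Reachable o a at h1oa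
  change ¬ (openGraph _).Reachable o c at h1oc
  change (openGraph _).Reachable o b at h1ob
  change ¬ (openGraph _).Reachable o b at h2ob
  change ¬ (openGraph _).Reachable o c at h2oc
  change (openGraph _).Reachable o a at h2oa
  have hN2' : ∀ z, z ≠ o → s(o, z) ∈ _ → (z = b ∨ z = a ∨ z ∈ R) := fun z hz he => by
    rcases hN2 z hz he with h | h | h
    · exact Or.inr (Or.inl h)
    · exact Or.inl h
    · exact Or.inr (Or.inr h)
  have hη₁ := mem_cfg_swap o y x
  have hη₂ := mem_cfg_swap o x y
  obtain ⟨hΓη₁, hoaη₁, hacη₁⟩ :=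
    hybrid_mem_T_of_terminalNbrs (R := R) hao hN1 hη₁ h1oa h2oa h2ob h2oc hΓ2
  obtain ⟨hΓη₂, hobη₂, hbcη₂⟩ :=
    hybrid_mem_T_of_terminalNbrs (R := R) hbo hN2' hη₂ h2ob h1ob h1oa h1oc hΓ1
  exact ⟨⟨⟨(memΓ _).2 hΓη₁, hoaη₁⟩, hacη₁⟩, ⟨⟨(memΓ _).2 hΓη₂, hobη₂⟩, hbcη₂⟩⟩

/-- **RC1 when the neighbours of `o` are terminals (THEOREM).**  If every edge from `o` to a vertex other than
`a`, `b` and the core carries weight `0` (so the support has no Steiner neighbour of `o`; Steiner vertices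
elsewhere are allowed), then the random-core pair exchange `S_a S_b ≤ T_a T_b` holds for this weight vector —
`corePairExchange_inter_terminalNbrs` plus "weight-zero edges are a.s. closed"
(`prodBernoulli_setOf_exists_mem_eq_zero`).  Generalises `steinerFree_corePairExchange`. [this file] -/
theorem corePairExchange_of_terminalNbrs (w : Sym2 (Fin n) → unitInterval) (o a b c : Fin n)
    (R : Finset (Fin n)) (hao : a ≠ o) (hbo : b ≠ o)
    (hw : ∀ z, z ≠ o → z ≠ a → z ≠ b → z ∉ R → ((w s(o, z) : unitInterval) : ℝ) = 0) :
    (prodBernoulli w).real ((⋂ r ∈ R, (openConn c r : Set (BondConfig (Fin n)))) ∩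
          (openConn o a : Set (BondConfig (Fin n)))ᶜ ∩ (openConn o c)ᶜ ∩ openConn o b) *
        (prodBernoulli w).real ((⋂ r ∈ R, (openConn c r : Set (BondConfig (Fin n)))) ∩
          (openConn o b : Set (BondConfig (Fin n)))ᶜ ∩ (openConn o c)ᶜ ∩ openConn o a) ≤
      (prodBernoulli w).real ((⋂ r ∈ R, (openConn c r : Set (BondConfig (Fin n)))) ∩
          (openConn o a : Set (BondConfig (Fin n)))ᶜ ∩ (openConn a c)ᶜ) *
        (prodBernoulli w).real ((⋂ r ∈ R, (openConn c r : Set (BondConfig (Fin n)))) ∩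
          (openConn o b : Set (BondConfig (Fin n)))ᶜ ∩ (openConn b c)ᶜ) := by
  classical
  set μ := prodBernoulli w with hμ
  -- the weight-zero star of `o` towards non-terminals is a.s. closed
  set F₀ : Finset (Sym2 (Fin n)) :=
    (Finset.univ.filter fun z : Fin n => z ≠ o ∧ z ≠ a ∧ z ≠ b ∧ z ∉ R).image fun z => s(o, z) with hF₀
  have hZ : μ.real {ω : BondConfig (Fin n) | ∃ e ∈ F₀, e ∈ ω} = 0 := by
    have h0 : μ {ω : BondConfig (Fin n) | ∃ e ∈ F₀, e ∈ ω} = 0 := by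
      refine prodBernoulli_setOf_exists_mem_eq_zero w F₀ fun e he => ?_
      obtain ⟨z, hz, rfl⟩ := Finset.mem_image.1 he
      obtain ⟨hzo, hza, hzb, hzR⟩ := (Finset.mem_filter.1 hz).2
      exact hw z hzo hza hzb hzR
    simp [measureReal_def, h0]
  -- off `N` one of those edges is open
  have hsub : ∀ S : Set (BondConfig (Fin n)),
      S \ {ω : BondConfig (Fin n) | ∀ z, z ≠ o → s(o, z) ∈ ω → (z = a ∨ z = b ∨ z ∈ R)} ⊆
        {ω : BondConfig (Fin n) | ∃ e ∈ F₀, e ∈ ω} := by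
    intro S ω hω
    obtain ⟨-, hωN⟩ := hω
    simp only [Set.mem_setOf_eq, not_forall] at hωN
    obtain ⟨z, hzo, hez, hz⟩ := hωN
    have hza : z ≠ a := fun h => hz (Or.inl h)
    have hzb : z ≠ b := fun h => hz (Or.inr (Or.inl h))
    have hzR : z ∉ R := fun h => hz (Or.inr (Or.inr h))
    refine ⟨s(o, z), ?_, hez⟩
    exact Finset.mem_image.2 ⟨z, Finset.mem_filter.2 ⟨Finset.mem_univ _, hzo, hza, hzb, hzR⟩, rfl⟩
  have hle : ∀ S : Set (BondConfig (Fin n)), μ.real S ≤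
      μ.real (S ∩ {ω : BondConfig (Fin n) | ∀ z, z ≠ o → s(o, z) ∈ ω → (z = a ∨ z = b ∨ z ∈ R)}) := by
    intro S
    have h0 : μ.real (S \ {ω : BondConfig (Fin n) | ∀ z, z ≠ o → s(o, z) ∈ ω → (z = a ∨ z = b ∨ z ∈ R)}) = 0 :=
      measureReal_mono_null (hsub S) hZ
    calc μ.real S = μ.real ((S ∩ {ω : BondConfig (Fin n) | ∀ z, z ≠ o → s(o, z) ∈ ω → (z = a ∨ z = b ∨ z ∈ R)}) ∪
          (S \ {ω : BondConfig (Fin n) | ∀ z, z ≠ o → s(o, z) ∈ ω → (z = a ∨ z = b ∨ z ∈ R)})) := by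
            rw [Set.inter_union_sdiff]
      _ ≤ μ.real (S ∩ {ω : BondConfig (Fin n) | ∀ z, z ≠ o → s(o, z) ∈ ω → (z = a ∨ z = b ∨ z ∈ R)}) +
          μ.real (S \ {ω : BondConfig (Fin n) | ∀ z, z ≠ o → s(o, z) ∈ ω → (z = a ∨ z = b ∨ z ∈ R)}) :=
            measureReal_union_le _ _
      _ = _ := by rw [h0, add_zero]
  have key := corePairExchange_inter_terminalNbrs w o a b c R hao hbo
  exact (mul_le_mul (hle _) (hle _) measureReal_nonneg measureReal_nonneg).trans key


/-! ### Floating-sink REG₂ / RWF₂ -/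

/-- **Floating-sink event gluing REG₂ on Steiner-free supports.**  With `Γ = ⋂_{r ∈ R} {c ↔ r}` and both
core-disconnections `μ(Γ ∩ {a↮c}), μ(Γ ∩ {b↮c}) ≤ s`: `μ(Γ ∩ {o↮c} ∩ ({o↔a} ∪ {o↔b})) ≤ s`.
(`CoreExchange.eventGluing_pair_within` + `steinerFree_corePairExchange`.) [this file] -/
theorem steinerFree_coreEventGluing_pair (w : Sym2 (Fin n) → unitInterval) (o a b c : Fin n)
    (R : Finset (Fin n)) (hV : ∀ v, v = o ∨ v = a ∨ v = b ∨ v ∈ R) (hao : a ≠ o) (hbo : b ≠ o)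
    (haR : a ∉ R) (hbR : b ∉ R) (hcR : c ∈ R) (hab : a ≠ b) (s : ℝ)
    (ha : (prodBernoulli w).real ((⋂ r ∈ R, (openConn c r : Set (BondConfig (Fin n)))) ∩
      (openConn a c : Set (BondConfig (Fin n)))ᶜ) ≤ s)
    (hb : (prodBernoulli w).real ((⋂ r ∈ R, (openConn c r : Set (BondConfig (Fin n)))) ∩
      (openConn b c : Set (BondConfig (Fin n)))ᶜ) ≤ s) :
    (prodBernoulli w).real ((⋂ r ∈ R, (openConn c r : Set (BondConfig (Fin n)))) ∩
      (openConn o c : Set (BondConfig (Fin n)))ᶜ ∩ ⋃ y ∈ ({a, b} : Finset (Fin n)), openConn o y) ≤ s :=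
  eventGluing_pair_within w (⋂ r ∈ R, (openConn c r : Set (BondConfig (Fin n)))) o c a b hab s
    (steinerFree_corePairExchange w o a b c R hV hao hbo haR hbR hcR) ha hb

/-- **Floating-sink worst-first packing RWF₂ on Steiner-free supports.**  With `Γ` the core literal and `a` the worse
floating relay (`μ(Γ ∩ {b↮c}) ≤ μ(Γ ∩ {a↮c})`):
`μ(Γ ∩ {a↮c}) · μ(Γ ∩ {o↮a} ∩ {o↮c} ∩ {o↔b}) ≤ μ(Γ ∩ {b↮c}) · μ(Γ ∩ {o↮a} ∩ {a↮c})`. [this file] -/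
theorem steinerFree_coreWorstFirst_two_mul (w : Sym2 (Fin n) → unitInterval) (o a b c : Fin n)
    (R : Finset (Fin n)) (hV : ∀ v, v = o ∨ v = a ∨ v = b ∨ v ∈ R) (hao : a ≠ o) (hbo : b ≠ o)
    (haR : a ∉ R) (hbR : b ∉ R) (hcR : c ∈ R)
    (hworse : (prodBernoulli w).real ((⋂ r ∈ R, (openConn c r : Set (BondConfig (Fin n)))) ∩
        (openConn b c : Set (BondConfig (Fin n)))ᶜ) ≤
      (prodBernoulli w).real ((⋂ r ∈ R, (openConn c r : Set (BondConfig (Fin n)))) ∩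
        (openConn a c : Set (BondConfig (Fin n)))ᶜ)) :
    (prodBernoulli w).real ((⋂ r ∈ R, (openConn c r : Set (BondConfig (Fin n)))) ∩
          (openConn a c : Set (BondConfig (Fin n)))ᶜ) *
        (prodBernoulli w).real ((⋂ r ∈ R, (openConn c r : Set (BondConfig (Fin n)))) ∩
          (openConn o a : Set (BondConfig (Fin n)))ᶜ ∩ (openConn o c)ᶜ ∩ openConn o b) ≤
      (prodBernoulli w).real ((⋂ r ∈ R, (openConn c r : Set (BondConfig (Fin n)))) ∩
          (openConn b c : Set (BondConfig (Fin n)))ᶜ) *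
        (prodBernoulli w).real ((⋂ r ∈ R, (openConn c r : Set (BondConfig (Fin n)))) ∩
          (openConn o a : Set (BondConfig (Fin n)))ᶜ ∩ (openConn a c)ᶜ) :=
  worstFirst_two_mul_within w (⋂ r ∈ R, (openConn c r : Set (BondConfig (Fin n)))) o c a b hworse
    (steinerFree_corePairExchange w o a b c R hV hao hbo haR hbR hcR)

/-- **Floating-sink event gluing REG₂ when the neighbours of `o` are terminals.** [this file] -/
theorem terminalNbrs_coreEventGluing_pair (w : Sym2 (Fin n) → unitInterval) (o a b c : Fin n)
    (R : Finset (Fin n)) (hao : a ≠ o) (hbo : b ≠ o) (hab : a ≠ b)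
    (hw : ∀ z, z ≠ o → z ≠ a → z ≠ b → z ∉ R → ((w s(o, z) : unitInterval) : ℝ) = 0) (s : ℝ)
    (ha : (prodBernoulli w).real ((⋂ r ∈ R, (openConn c r : Set (BondConfig (Fin n)))) ∩
      (openConn a c : Set (BondConfig (Fin n)))ᶜ) ≤ s)
    (hb : (prodBernoulli w).real ((⋂ r ∈ R, (openConn c r : Set (BondConfig (Fin n)))) ∩
      (openConn b c : Set (BondConfig (Fin n)))ᶜ) ≤ s) :
    (prodBernoulli w).real ((⋂ r ∈ R, (openConn c r : Set (BondConfig (Fin n)))) ∩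
      (openConn o c : Set (BondConfig (Fin n)))ᶜ ∩ ⋃ y ∈ ({a, b} : Finset (Fin n)), openConn o y) ≤ s :=
  eventGluing_pair_within w (⋂ r ∈ R, (openConn c r : Set (BondConfig (Fin n)))) o c a b hab s
    (corePairExchange_of_terminalNbrs w o a b c R hao hbo hw) ha hb

/-- **Floating-sink worst-first packing RWF₂ when the neighbours of `o` are terminals.** [this file] -/
theorem terminalNbrs_coreWorstFirst_two_mul (w : Sym2 (Fin n) → unitInterval) (o a b c : Fin n)
    (R : Finset (Fin n)) (hao : a ≠ o) (hbo : b ≠ o)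
    (hw : ∀ z, z ≠ o → z ≠ a → z ≠ b → z ∉ R → ((w s(o, z) : unitInterval) : ℝ) = 0)
    (hworse : (prodBernoulli w).real ((⋂ r ∈ R, (openConn c r : Set (BondConfig (Fin n)))) ∩
        (openConn b c : Set (BondConfig (Fin n)))ᶜ) ≤
      (prodBernoulli w).real ((⋂ r ∈ R, (openConn c r : Set (BondConfig (Fin n)))) ∩
        (openConn a c : Set (BondConfig (Fin n)))ᶜ)) :
    (prodBernoulli w).real ((⋂ r ∈ R, (openConn c r : Set (BondConfig (Fin n)))) ∩
          (openConn a c : Set (BondConfig (Fin n)))ᶜ) *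
        (prodBernoulli w).real ((⋂ r ∈ R, (openConn c r : Set (BondConfig (Fin n)))) ∩
          (openConn o a : Set (BondConfig (Fin n)))ᶜ ∩ (openConn o c)ᶜ ∩ openConn o b) ≤
      (prodBernoulli w).real ((⋂ r ∈ R, (openConn c r : Set (BondConfig (Fin n)))) ∩
          (openConn b c : Set (BondConfig (Fin n)))ᶜ) *
        (prodBernoulli w).real ((⋂ r ∈ R, (openConn c r : Set (BondConfig (Fin n)))) ∩
          (openConn o a : Set (BondConfig (Fin n)))ᶜ ∩ (openConn a c)ᶜ) :=
  worstFirst_two_mul_within w (⋂ r ∈ R, (openConn c r : Set (BondConfig (Fin n)))) o c a b hworse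
    (corePairExchange_of_terminalNbrs w o a b c R hao hbo hw)

end CoreExchange

end Summit.CriticalPhenomena.PercolationContinuityZ3.Theorems

end
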